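import Summits.QuantumFields.YangMills.Theorems.LangevinControlUVOSLegsFromFemtoAndGapStubAssemblyShiftedBound
import HarnessLib

/-!
# Infinite volume by compactness with UV SLACK in the collar bound: the E0′ majorants (toolkit X-a/X-b twins)

Support file for `SlackWindow.SlackCalibration` (stmt-QuantumFields-23098; planner ym-idea-11 g8, LINE 1 «wuc»).  The landed
toolkit X-a/X-b (`OSLegsFromFemtoAndGap.pointwise_bound'`, `sum_abs_weight_mul_norm_le`) bounds `Σₓ |W x|·‖F(y x)‖` for abstract
weights with a sup bound `Mⁿ` and the collar bound `(C/R⁴)ⁿ` at torus-separated sites.  Route `SlackWindow` delivers the WEAKER collar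
currency with polynomial UV slack `(C/R⁴·((R·a)⁻¹)^σ)ⁿ` (`σ : ℕ`; `σ = 0` is the landed case).  Here the FAR regime is re-proved
with the slack paid by the off-diagonal Taylor gain of order `(σ+4)n` of `F ∈ ⁰𝒮ₙ` (`offDiagonal_pow_mul_norm_le`): with
`R⁻¹ ≤ 12/δ + aκ` (`δ` the minimal pair distance, `κ = 2/ℓ₄+48`), `(12/δ)^{(σ+4)n}(4aδ)^{(σ+4)n}a^{−σn} = 48^{(σ+4)n}a^{4n}` and
`(aκ)^{(σ+4)n}a^{−σn} = κ^{(σ+4)n}a^{4n}` — the majorant keeps the Riemann factor `a^{4n}`.  Wrap and near-diagonal regimes use only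
the sup bound (cited BY NAME).  Outputs: `pointwise_bound_slack` (constant `K₀ = M·4⁴·5⁶ + M·2⁶·(10+2s)⁴ + 2^{σ+11}·C·κ^{σ+4}`,
seven seminorms of orders `≤ (σ+10)n`) and the summed bounds `sum_abs_weight_mul_norm_le_slack` / `norm_sum_weight_mul_le_slack`
on `(box L)ⁿ` (verbatim X-b with the new constant).  HONEST FRAMING: pure soft analysis ([folklore]); nothing about Bałaban's RG,
reflection positivity, a mass gap or Clay; no summit is proved (rung R2a plumbing).
References: Osterwalder–Schrader CMP 42 (1975) §2; Glimm–Jaffe (1987) §6.1; Kravchuk–Qiao–Rychkov arXiv:2104.02090 Rem. 2.4.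
-/

set_option autoImplicit false

noncomputable section

open scoped SchwartzMap BigOperators
open MeasureTheory Filter Topology
open Literature.MathematicalPhysics.QuantumFieldTheory Literature.MathematicalPhysics.QuantumLattice
open Literature.MathematicalPhysics.AQFT
open Literature.Probability.LatticeModels (box Site)
open Summit.QuantumFields.YangMills.Theorems.OSLegsFromFemtoAndGap

namespace Summit.QuantumFields.YangMills.Theorems.InfiniteVolume.Slack

variable {n : ℕ}

/-! ### Elementary algebra of the slack currency -/

/-- `C/R⁴·((R a)⁻¹)^σ = C·(R⁻¹)^{σ+4}·(a⁻¹)^σ`. [folklore] -/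
theorem slackCollar_eq {C R a : ℝ} (σ : ℕ) :
    C / R ^ 4 * ((R * a)⁻¹) ^ σ = C * (R⁻¹) ^ (σ + 4) * (a⁻¹) ^ σ := by
  rw [mul_inv, mul_pow, pow_add, div_eq_mul_inv, ← inv_pow]
  ring

/-- `a^{(σ+4)n} · (a⁻¹)^{σn} = a^{4n}` for `a ≠ 0`. [folklore] -/
theorem pow_mul_inv_pow_eq {a : ℝ} (ha : a ≠ 0) (σ n : ℕ) :
    a ^ ((σ + 4) * n) * (a⁻¹) ^ (σ * n) = a ^ (4 * n) := by
  rw [add_mul, pow_add, inv_pow, mul_assoc, mul_comm (a ^ (4 * n)), ← mul_assoc, mul_inv_cancel₀ (pow_ne_zero _ ha),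
    one_mul]

/-! ### The separated regime with slack -/

/-- **Separated regime, shifted points, SLACK currency** (`s ≤ δ`): the collar bound `(C/R⁴·((R a)⁻¹)^σ)ⁿ` with
`R⁻¹ ≤ 12/δ + a(2/ℓ₄+24)` is converted into `a^{4n}` times Schwartz seminorms of orders `(0,(σ+4)n)`, `(6n,(σ+4)n)`, `(0,0)`,
`(6n,0)`, the slack `a^{−σn}` being paid by the off-diagonal vanishing of `F` to order `(σ+4)n`. [folklore] -/
theorem weight_bound_far_slack (F : 𝓢((Fin n → EuclideanSpace ℝ (Fin 4)), ℂ)) (hF : IsOffDiagonal F) {a s : ℝ} (ha : 0 < a)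
    (x : Fin n → Site 4) {i j : Fin n} (hij : i ≠ j) {δ : ℝ} (hδ : 0 < δ) (hsδ : s ≤ δ)
    (hδx : ‖x i - x j‖ ≤ δ) (y : Fin n → EuclideanSpace ℝ (Fin 4)) (hyx : ∀ l, ‖y l - a • siteToE (x l)‖ ≤ s * a)
    {W C R ℓ₄ : ℝ} (hC : 0 ≤ C) (hR : 0 < R) (hℓ : 0 < ℓ₄) (σ : ℕ)
    (hW : |W| ≤ (C / R ^ 4 * ((R * a)⁻¹) ^ σ) ^ n)
    (hRinv : R⁻¹ ≤ 12 / δ + a * (2 / ℓ₄ + 24)) :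
    |W| * ‖F y‖ * (1 + ‖y‖) ^ (6 * n) ≤
      (2 ^ (σ + 11) * C * (2 / ℓ₄ + 48) ^ (σ + 4)) ^ n * a ^ (4 * n) *
        (SchwartzMap.seminorm ℂ 0 ((σ + 4) * n) F + SchwartzMap.seminorm ℂ (6 * n) ((σ + 4) * n) F +
          SchwartzMap.seminorm ℂ 0 0 F + SchwartzMap.seminorm ℂ (6 * n) 0 F) := by
  set κ : ℝ := 2 / ℓ₄ + 48 with hκ
  set m : ℕ := σ + 4 with hm
  have h2ℓ : 0 < 2 / ℓ₄ := div_pos two_pos hℓ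
  have hκ48 : (48 : ℝ) ≤ κ := (by rw [hκ]; linarith); have hκpos : 0 < κ := by linarith
  set u : ℝ := 12 / δ with hu
  set v : ℝ := a * κ with hv
  have hu0 : 0 ≤ u := (by positivity); have hv0 : 0 ≤ v := by positivity
  have hRinv' : R⁻¹ ≤ u + v := hRinv.trans (by rw [hu, hv, hκ]; nlinarith)
  -- `(p+q)^l ≤ 2^l (p^l + q^l)` (cf. `Literature.NumberTheory.LFunctions.add_pow_le_two_pow`, not imported here)
  have hsplit : ∀ {p q : ℝ}, 0 ≤ p → 0 ≤ q → ∀ l : ℕ, (p + q) ^ l ≤ 2 ^ l * (p ^ l + q ^ l) := by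
    intro p q hp hq l
    calc (p + q) ^ l ≤ (2 * max p q) ^ l := by
          refine pow_le_pow_left₀ (by positivity) ?_ l
          rcases le_total p q with h | h
          · rw [max_eq_right h]; linarith
          · rw [max_eq_left h]; linarith
      _ = 2 ^ l * (max p q) ^ l := mul_pow _ _ _
      _ ≤ 2 ^ l * (p ^ l + q ^ l) := by
          gcongr
          rcases le_total p q with h | h
          · rw [max_eq_right h]; linarith [pow_nonneg hp l]
          · rw [max_eq_left h]; linarith [pow_nonneg hq l]
  -- Step 1: `|W| ≤ Cⁿ (a⁻¹)^{σn} 2^{mn} 2ⁿ (u^{mn} + v^{mn})`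
  have hRm : (R⁻¹) ^ m ≤ 2 ^ m * (u ^ m + v ^ m) :=
    (pow_le_pow_left₀ (by positivity) hRinv' m).trans (hsplit hu0 hv0 m)
  have hWle : |W| ≤ C ^ n * (a⁻¹) ^ (σ * n) * (2 ^ (m * n) * 2 ^ n * (u ^ (m * n) + v ^ (m * n))) := by
    have h1 : |W| ≤ (C * (R⁻¹) ^ m * (a⁻¹) ^ σ) ^ n := by rw [← slackCollar_eq]; exact hW
    have h2 : (C * (R⁻¹) ^ m * (a⁻¹) ^ σ) ^ n = C ^ n * (a⁻¹) ^ (σ * n) * ((R⁻¹) ^ m) ^ n := by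
      rw [mul_pow, mul_pow, ← pow_mul (a⁻¹)]; ring
    have h3 : ((R⁻¹) ^ m) ^ n ≤ (2 ^ m * (u ^ m + v ^ m)) ^ n := pow_le_pow_left₀ (by positivity) hRm n
    have h4 : (2 ^ m * (u ^ m + v ^ m)) ^ n ≤ 2 ^ (m * n) * 2 ^ n * (u ^ (m * n) + v ^ (m * n)) := by
      rw [mul_pow, ← pow_mul]
      have := hsplit (pow_nonneg hu0 m) (pow_nonneg hv0 m) n
      rw [← pow_mul, ← pow_mul] at this
      calc (2 : ℝ) ^ (m * n) * (u ^ m + v ^ m) ^ n ≤ 2 ^ (m * n) * (2 ^ n * (u ^ (m * n) + v ^ (m * n))) := by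
            gcongr
        _ = _ := by ring
    rw [h2] at h1
    exact h1.trans (mul_le_mul_of_nonneg_left (h3.trans h4) (by positivity))
  -- Step 2: flat decay of order `m n` for the `u`-part: `‖yᵢ − yⱼ‖ ≤ 4aδ`, `u·4aδ = 48a`
  have hsep : ‖y i - y j‖ ≤ 4 * a * δ := by
    have h1 := norm_sub_le_of_shift ha.le hyx i j
    have h2 : (2 * a) * ‖x i - x j‖ ≤ (2 * a) * δ := mul_le_mul_of_nonneg_left hδx (by positivity)
    nlinarith
  have hflat0 := offDiagonal_pow_mul_norm_le F hF 0 (m * n) hij y; rw [pow_zero, one_mul] at hflat0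
  have hflat6 := offDiagonal_pow_mul_norm_le F hF (6 * n) (m * n) hij y
  have hpw : ‖y i - y j‖ ^ (m * n) ≤ (4 * a * δ) ^ (m * n) := pow_le_pow_left₀ (norm_nonneg _) hsep _
  have hδpow : u ^ (m * n) * (4 * a * δ) ^ (m * n) = (48 * a) ^ (m * n) := by
    rw [← mul_pow]; congr 1; rw [hu]; field_simp; ring
  set S0m := SchwartzMap.seminorm ℂ 0 (m * n) F
  set S6m := SchwartzMap.seminorm ℂ (6 * n) (m * n) F
  set S00 := SchwartzMap.seminorm ℂ 0 0 F
  set S60 := SchwartzMap.seminorm ℂ (6 * n) 0 F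
  have hA : ‖(((u ^ (m * n) : ℝ)) : ℂ) • F y‖ ≤ S0m * (48 * a) ^ (m * n) := by
    rw [norm_smul, Complex.norm_real, Real.norm_of_nonneg (by positivity)]
    calc u ^ (m * n) * ‖F y‖ ≤ u ^ (m * n) * (S0m * (4 * a * δ) ^ (m * n)) := by
          gcongr; exact hflat0.trans (mul_le_mul_of_nonneg_left hpw (apply_nonneg _ _))
      _ = S0m * (u ^ (m * n) * (4 * a * δ) ^ (m * n)) := by ring
      _ = _ := by rw [hδpow]
  have hB : ‖y‖ ^ (6 * n) * ‖(((u ^ (m * n) : ℝ)) : ℂ) • F y‖ ≤ S6m * (48 * a) ^ (m * n) := by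
    rw [norm_smul, Complex.norm_real, Real.norm_of_nonneg (by positivity)]
    calc ‖y‖ ^ (6 * n) * (u ^ (m * n) * ‖F y‖) = u ^ (m * n) * (‖y‖ ^ (6 * n) * ‖F y‖) := by ring
      _ ≤ u ^ (m * n) * (S6m * (4 * a * δ) ^ (m * n)) :=
          mul_le_mul_of_nonneg_left (hflat6.trans (mul_le_mul_of_nonneg_left hpw (apply_nonneg _ _))) (by positivity)
      _ = S6m * (u ^ (m * n) * (4 * a * δ) ^ (m * n)) := by ring
      _ = _ := by rw [hδpow]
  have hcomb1 := norm_mul_one_add_pow_le hA hB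
  rw [norm_smul, Complex.norm_real, Real.norm_of_nonneg (by positivity : (0:ℝ) ≤ u ^ (m * n))] at hcomb1
  -- Step 3: plain decay for the `v`-part
  have hA0 : ‖F y‖ ≤ S00 := by
    have := pow_mul_norm_le_seminorm F 0 y; rwa [pow_zero, one_mul] at this
  have hB0 : ‖y‖ ^ (6 * n) * ‖F y‖ ≤ S60 := pow_mul_norm_le_seminorm F (6 * n) y
  have hcomb2 := norm_mul_one_add_pow_le hA0 hB0
  -- Step 4: assemble
  have hS0m : 0 ≤ S0m := apply_nonneg _ _; have hS6m : 0 ≤ S6m := apply_nonneg _ _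
  have hS00 : 0 ≤ S00 := apply_nonneg _ _; have hS60 : 0 ≤ S60 := apply_nonneg _ _
  have hpos1 : 0 ≤ ‖F y‖ * (1 + ‖y‖) ^ (6 * n) := by positivity
  have h48 : (48 * a) ^ (m * n) ≤ (κ * a) ^ (m * n) := pow_le_pow_left₀ (by positivity) (by nlinarith) _
  have hapow : a ^ (m * n) * (a⁻¹) ^ (σ * n) = a ^ (4 * n) := pow_mul_inv_pow_eq ha.ne' σ n
  calc |W| * ‖F y‖ * (1 + ‖y‖) ^ (6 * n) = |W| * (‖F y‖ * (1 + ‖y‖) ^ (6 * n)) := by ring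
    _ ≤ C ^ n * (a⁻¹) ^ (σ * n) * (2 ^ (m * n) * 2 ^ n * (u ^ (m * n) + v ^ (m * n))) *
          (‖F y‖ * (1 + ‖y‖) ^ (6 * n)) := mul_le_mul_of_nonneg_right hWle hpos1
    _ = C ^ n * (a⁻¹) ^ (σ * n) * (2 ^ (m * n) * 2 ^ n) *
          ((u ^ (m * n) * ‖F y‖ * (1 + ‖y‖) ^ (6 * n)) + v ^ (m * n) * (‖F y‖ * (1 + ‖y‖) ^ (6 * n))) := by ring
    _ ≤ C ^ n * (a⁻¹) ^ (σ * n) * (2 ^ (m * n) * 2 ^ n) *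
          (2 ^ (6 * n) * (S0m * (48 * a) ^ (m * n) + S6m * (48 * a) ^ (m * n)) +
            v ^ (m * n) * (2 ^ (6 * n) * (S00 + S60))) := by gcongr
    _ ≤ C ^ n * (a⁻¹) ^ (σ * n) * (2 ^ (m * n) * 2 ^ n) *
          (2 ^ (6 * n) * (S0m * (κ * a) ^ (m * n) + S6m * (κ * a) ^ (m * n)) +
            v ^ (m * n) * (2 ^ (6 * n) * (S00 + S60))) := by gcongr
    _ = C ^ n * (2 ^ (m * n) * 2 ^ n * 2 ^ (6 * n)) * κ ^ (m * n) * (a ^ (m * n) * (a⁻¹) ^ (σ * n)) *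
          (S0m + S6m + S00 + S60) := by rw [hv, mul_pow κ a, mul_pow a κ]; ring
    _ = (2 ^ (σ + 11) * C * κ ^ (σ + 4)) ^ n * a ^ (4 * n) * (S0m + S6m + S00 + S60) := by
          rw [hapow, hm]
          simp only [mul_pow, ← pow_mul]
          have e : (2 : ℝ) ^ ((σ + 4) * n) * 2 ^ n * 2 ^ (6 * n) = 2 ^ ((σ + 11) * n) := by
            rw [← pow_add, ← pow_add]; congr 1; ring
          rw [← e]; ring

/-- **Separated regime of the per-point bound, abstract weights, shifted points, SLACK currency.** [folklore] -/
theorem pointwise_bound_far_slack {C ℓ₄ a s : ℝ} {L n : ℕ} (hℓ : 0 < ℓ₄) (hC : 0 ≤ C) (σ : ℕ)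
    (W : (Fin n → Site 4) → ℝ)
    (H : ∀ (x : Fin n → Site 4) (R : ℕ), 1 ≤ R → (R : ℝ) * a ≤ ℓ₄ → 4 * R + 8 ≤ L →
      (∀ i j : Fin n, i ≠ j → ∃ k : Fin 4,
        (2 * (R : ℤ) + 4) ≤ |((((x i k - x j k : ℤ) : ZMod (2 * L + 1))).valMinAbs : ℤ)|) →
      |W x| ≤ (C / (R : ℝ) ^ 4 * (((R : ℝ) * a)⁻¹) ^ σ) ^ n)
    (ha : 0 < a) (ha1 : a ≤ 1) (haℓ : a ≤ ℓ₄) (hL14 : 14 ≤ L) (hLa : a⁻¹ * a⁻¹ ≤ L) (hn : 2 ≤ n)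
    (hs6 : s ≤ 6) (F : 𝓢((Fin n → EuclideanSpace ℝ (Fin 4)), ℂ)) (hF : IsOffDiagonal F) (x : Fin n → Site 4)
    (y : Fin n → EuclideanSpace ℝ (Fin 4)) (hyx : ∀ l, ‖y l - a • siteToE (x l)‖ ≤ s * a)
    (hwrap : ∀ i, 2 * ‖x i‖ ≤ (L : ℝ)) (hnear : ∀ i j : Fin n, i ≠ j → 5 < ‖x i - x j‖) :
    |W x| * ‖F y‖ * (1 + ‖y‖) ^ (6 * n) ≤
      (2 ^ (σ + 11) * C * (2 / ℓ₄ + 48) ^ (σ + 4)) ^ n * a ^ (4 * n) *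
        (SchwartzMap.seminorm ℂ 0 ((σ + 4) * n) F + SchwartzMap.seminorm ℂ (6 * n) ((σ + 4) * n) F +
          SchwartzMap.seminorm ℂ 0 0 F + SchwartzMap.seminorm ℂ (6 * n) 0 F) := by
  classical
  have hpairs : (Finset.univ.filter fun p : Fin n × Fin n => p.1 ≠ p.2).Nonempty := by
    refine ⟨(⟨0, by omega⟩, ⟨1, by omega⟩), ?_⟩
    simp [Fin.ext_iff]
  obtain ⟨⟨i₀, j₀⟩, hmem, hmin⟩ :=
    Finset.exists_min_image _ (fun p : Fin n × Fin n => ‖x p.1 - x p.2‖) hpairs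
  simp only [Finset.mem_filter, Finset.mem_univ, true_and] at hmem
  set δ : ℝ := ‖x i₀ - x j₀‖ with hδ
  have hδ5 : 5 < δ := hnear i₀ j₀ hmem
  have hδmin : ∀ i j : Fin n, i ≠ j → δ ≤ ‖x i - x j‖ := fun i j hij =>
    hmin (i, j) (by simp [hij])
  have hδ6 : 6 ≤ δ := by
    obtain ⟨k₀, hk₀⟩ := exists_norm_eq_abs_coord (x i₀ - x j₀)
    have h1 : δ = ((|(x i₀ - x j₀) k₀| : ℤ) : ℝ) := by rw [hδ, hk₀, Int.cast_abs]
    have h2 : (5 : ℝ) < ((|(x i₀ - x j₀) k₀| : ℤ) : ℝ) := h1 ▸ hδ5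
    have h3 : (5 : ℤ) < |(x i₀ - x j₀) k₀| := by exact_mod_cast h2
    have h4 : (6 : ℤ) ≤ |(x i₀ - x j₀) k₀| := h3
    rw [h1]; exact_mod_cast h4
  have hδpos : 0 < δ := by linarith
  obtain ⟨R, hR1, hRa, hRL, hRδ, hRinv⟩ := exists_collar_radius hδ6 hℓ ha ha1 haℓ hL14 hLa
  have hRpos : (0 : ℝ) < R := by exact_mod_cast hR1
  have hsepR : ∀ i j : Fin n, i ≠ j → ∃ k : Fin 4,
      (2 * (R : ℤ) + 4) ≤ |((((x i k - x j k : ℤ) : ZMod (2 * L + 1))).valMinAbs : ℤ)| := by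
    intro i j hij
    obtain ⟨k, hk⟩ := exists_valMinAbs_ge_of_norm_le x hwrap i j (hRδ.trans (hδmin i j hij))
    exact ⟨k, by exact_mod_cast hk⟩
  exact weight_bound_far_slack F hF ha x hmem hδpos (hs6.trans hδ6) (le_of_eq hδ.symm) y hyx hC hRpos hℓ σ
    (H x R hR1 hRa hRL hsepR) hRinv

/-- **Per-point bound, all regimes, abstract weights, shifted points, SLACK currency.**  With sup bound `Mⁿ` and slack collar
bound `(C/R⁴·((R a)⁻¹)^σ)ⁿ` on `W`, and `K₀ = M·4⁴·5⁶ + M·2⁶·(10+2s)⁴ + 2^{σ+11}·C·(2/ℓ₄+48)^{σ+4}`; seven seminorms of orders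
`≤ ((σ+10)n, (σ+10)n)`. [folklore] -/
theorem pointwise_bound_slack {C ℓ₄ M a s : ℝ} {L n : ℕ} (hℓ : 0 < ℓ₄) (hC : 0 ≤ C) (hM : 0 ≤ M) (σ : ℕ)
    (W : (Fin n → Site 4) → ℝ) (hWsup : ∀ x, |W x| ≤ M ^ n)
    (H : ∀ (x : Fin n → Site 4) (R : ℕ), 1 ≤ R → (R : ℝ) * a ≤ ℓ₄ → 4 * R + 8 ≤ L →
      (∀ i j : Fin n, i ≠ j → ∃ k : Fin 4,
        (2 * (R : ℤ) + 4) ≤ |((((x i k - x j k : ℤ) : ZMod (2 * L + 1))).valMinAbs : ℤ)|) →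
      |W x| ≤ (C / (R : ℝ) ^ 4 * (((R : ℝ) * a)⁻¹) ^ σ) ^ n)
    (ha : 0 < a) (ha1 : a ≤ 1) (haℓ : a ≤ ℓ₄) (hL14 : 14 ≤ L) (hLa : a⁻¹ * a⁻¹ ≤ L) (hn : 2 ≤ n)
    (hs : 0 ≤ s) (hs6 : s ≤ 6) (hsa : s * a ≤ 1 / 4)
    (F : 𝓢((Fin n → EuclideanSpace ℝ (Fin 4)), ℂ)) (hF : IsOffDiagonal F) (x : Fin n → Site 4)
    (y : Fin n → EuclideanSpace ℝ (Fin 4)) (hyx : ∀ l, ‖y l - a • siteToE (x l)‖ ≤ s * a) :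
    |W x| * ‖F y‖ * (1 + ‖y‖) ^ (6 * n) ≤
      (M * 4 ^ 4 * 5 ^ 6 + M * 2 ^ 6 * (10 + 2 * s) ^ 4 + 2 ^ (σ + 11) * C * (2 / ℓ₄ + 48) ^ (σ + 4)) ^ n *
        a ^ (4 * n) *
        (SchwartzMap.seminorm ℂ 0 (4 * n) F + SchwartzMap.seminorm ℂ (6 * n) (4 * n) F +
          SchwartzMap.seminorm ℂ 0 ((σ + 4) * n) F + SchwartzMap.seminorm ℂ (6 * n) ((σ + 4) * n) F +
          SchwartzMap.seminorm ℂ 0 0 F + SchwartzMap.seminorm ℂ (6 * n) 0 F +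
          SchwartzMap.seminorm ℂ (10 * n) 0 F) := by
  classical
  set κ : ℝ := 2 / ℓ₄ + 48 with hκ
  have hκ0 : 0 < κ := by rw [hκ]; positivity
  set τ : ℝ := 10 + 2 * s with hτ; have hτ0 : 0 < τ := by rw [hτ]; linarith
  set K₀ : ℝ := M * 4 ^ 4 * 5 ^ 6 + M * 2 ^ 6 * τ ^ 4 + 2 ^ (σ + 11) * C * κ ^ (σ + 4) with hK₀
  set S04 := SchwartzMap.seminorm ℂ 0 (4 * n) F
  set S64 := SchwartzMap.seminorm ℂ (6 * n) (4 * n) F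
  set S0m := SchwartzMap.seminorm ℂ 0 ((σ + 4) * n) F
  set S6m := SchwartzMap.seminorm ℂ (6 * n) ((σ + 4) * n) F
  set S00 := SchwartzMap.seminorm ℂ 0 0 F
  set S60 := SchwartzMap.seminorm ℂ (6 * n) 0 F
  set S10 := SchwartzMap.seminorm ℂ (10 * n) 0 F
  have hS04 : 0 ≤ S04 := apply_nonneg _ _; have hS64 : 0 ≤ S64 := apply_nonneg _ _
  have hS0m : 0 ≤ S0m := apply_nonneg _ _; have hS6m : 0 ≤ S6m := apply_nonneg _ _
  have hS00 : 0 ≤ S00 := apply_nonneg _ _; have hS60 : 0 ≤ S60 := apply_nonneg _ _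
  have hS10 : 0 ≤ S10 := apply_nonneg _ _; have ha4 : 0 ≤ a ^ (4 * n) := by positivity
  have hfar0 : 0 ≤ 2 ^ (σ + 11) * C * κ ^ (σ + 4) := by positivity
  have hKwrap : M * 4 ^ 4 * 5 ^ 6 ≤ K₀ := by rw [hK₀]; nlinarith [pow_pos hτ0 4]
  have hKnear : M * 2 ^ 6 * τ ^ 4 ≤ K₀ := by rw [hK₀]; nlinarith [pow_pos hτ0 4]
  have hKfar : 2 ^ (σ + 11) * C * κ ^ (σ + 4) ≤ K₀ := by rw [hK₀]; nlinarith [pow_pos hτ0 4]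
  have hK₀0 : 0 ≤ K₀ := le_trans (by positivity) hKwrap
  have hpow : ∀ u v w : ℝ, ∀ p q : ℕ, u ^ n * v ^ (p * n) * w ^ (q * n) = (u * v ^ p * w ^ q) ^ n :=
    fun u v w p q => by rw [mul_pow, mul_pow, ← pow_mul, ← pow_mul]
  by_cases hwrap : ∃ i, (L : ℝ) < 2 * ‖x i‖
  · obtain ⟨i, hi⟩ := hwrap
    calc _ ≤ M ^ n * 4 ^ (4 * n) * 5 ^ (6 * n) * a ^ (4 * n) * S10 :=
          weight_bound_wrap' F ha ha1 hsa hLa x hi y hyx hM (hWsup x)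
      _ = (M * 4 ^ 4 * 5 ^ 6) ^ n * a ^ (4 * n) * S10 := by rw [← hpow]
      _ ≤ K₀ ^ n * a ^ (4 * n) * (S04 + S64 + S0m + S6m + S00 + S60 + S10) := by
          have : S10 ≤ S04 + S64 + S0m + S6m + S00 + S60 + S10 := by linarith
          gcongr
  · push Not at hwrap
    by_cases hnear : ∃ i j : Fin n, i ≠ j ∧ ‖x i - x j‖ ≤ 5
    · obtain ⟨i, j, hij, hclose⟩ := hnear
      calc _ ≤ M ^ n * 2 ^ (6 * n) * τ ^ (4 * n) * a ^ (4 * n) * (S04 + S64) :=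
            weight_bound_near' F hF ha x hij hclose y hyx hM (hWsup x)
        _ = (M * 2 ^ 6 * τ ^ 4) ^ n * a ^ (4 * n) * (S04 + S64) := by rw [← hpow]
        _ ≤ K₀ ^ n * a ^ (4 * n) * (S04 + S64 + S0m + S6m + S00 + S60 + S10) := by
            have : S04 + S64 ≤ S04 + S64 + S0m + S6m + S00 + S60 + S10 := by linarith
            gcongr
    · push Not at hnear
      calc _ ≤ (2 ^ (σ + 11) * C * κ ^ (σ + 4)) ^ n * a ^ (4 * n) * (S0m + S6m + S00 + S60) :=
            pointwise_bound_far_slack hℓ hC σ W H ha ha1 haℓ hL14 hLa hn hs6 F hF x y hyx hwrap hnear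
        _ ≤ K₀ ^ n * a ^ (4 * n) * (S04 + S64 + S0m + S6m + S00 + S60 + S10) := by
            have : S0m + S6m + S00 + S60 ≤ S04 + S64 + S0m + S6m + S00 + S60 + S10 := by linarith
            gcongr

/-! ### Summation over a torus box (toolkit X-b twin) -/

/-- **Per-point bound with the summable lattice weight.**  `|W(x)| ‖F(y(x))‖ ≤ K₀ⁿ Σ(F) ∏ₗ 2⁶ a⁴ (1 + a‖xₗ‖)⁻⁶`
(`K₀` the per-point constant of `pointwise_bound_slack`). [folklore] -/
theorem abs_weight_mul_norm_le_prod_slack {C ℓ₄ M a s : ℝ} {L n : ℕ} (hℓ : 0 < ℓ₄) (hC : 0 ≤ C) (hM : 0 ≤ M) (σ : ℕ)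
    (W : (Fin n → Site 4) → ℝ) (hWsup : ∀ x, |W x| ≤ M ^ n)
    (H : ∀ (x : Fin n → Site 4) (R : ℕ), 1 ≤ R → (R : ℝ) * a ≤ ℓ₄ → 4 * R + 8 ≤ L →
      (∀ i j : Fin n, i ≠ j → ∃ k : Fin 4,
        (2 * (R : ℤ) + 4) ≤ |((((x i k - x j k : ℤ) : ZMod (2 * L + 1))).valMinAbs : ℤ)|) →
      |W x| ≤ (C / (R : ℝ) ^ 4 * (((R : ℝ) * a)⁻¹) ^ σ) ^ n)
    (ha : 0 < a) (ha1 : a ≤ 1) (haℓ : a ≤ ℓ₄) (hL14 : 14 ≤ L) (hLa : a⁻¹ * a⁻¹ ≤ L) (hn : 2 ≤ n)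
    (hs : 0 ≤ s) (hs6 : s ≤ 6) (hsa : s * a ≤ 1 / 4)
    (F : 𝓢((Fin n → EuclideanSpace ℝ (Fin 4)), ℂ)) (hF : IsOffDiagonal F) (x : Fin n → Site 4)
    (y : Fin n → EuclideanSpace ℝ (Fin 4)) (hyx : ∀ l, ‖y l - a • siteToE (x l)‖ ≤ s * a) :
    |W x| * ‖F y‖ ≤
      (M * 4 ^ 4 * 5 ^ 6 + M * 2 ^ 6 * (10 + 2 * s) ^ 4 + 2 ^ (σ + 11) * C * (2 / ℓ₄ + 48) ^ (σ + 4)) ^ n *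
        (SchwartzMap.seminorm ℂ 0 (4 * n) F + SchwartzMap.seminorm ℂ (6 * n) (4 * n) F +
          SchwartzMap.seminorm ℂ 0 ((σ + 4) * n) F + SchwartzMap.seminorm ℂ (6 * n) ((σ + 4) * n) F +
          SchwartzMap.seminorm ℂ 0 0 F + SchwartzMap.seminorm ℂ (6 * n) 0 F +
          SchwartzMap.seminorm ℂ (10 * n) 0 F) *
        ∏ i, (2 ^ 6 * (a ^ 4 * ((1 + a * ‖x i‖) ^ 6)⁻¹)) := by
  set K₀ : ℝ := M * 4 ^ 4 * 5 ^ 6 + M * 2 ^ 6 * (10 + 2 * s) ^ 4 + 2 ^ (σ + 11) * C * (2 / ℓ₄ + 48) ^ (σ + 4)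
  set Ssum := SchwartzMap.seminorm ℂ 0 (4 * n) F + SchwartzMap.seminorm ℂ (6 * n) (4 * n) F +
    SchwartzMap.seminorm ℂ 0 ((σ + 4) * n) F + SchwartzMap.seminorm ℂ (6 * n) ((σ + 4) * n) F +
    SchwartzMap.seminorm ℂ 0 0 F + SchwartzMap.seminorm ℂ (6 * n) 0 F + SchwartzMap.seminorm ℂ (10 * n) 0 F
  have hq : 0 < (1 + ‖y‖) ^ (6 * n) := by positivity
  have h1 := pointwise_bound_slack hℓ hC hM σ W hWsup H ha ha1 haℓ hL14 hLa hn hs hs6 hsa F hF x y hyx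
  have h2 : |W x| * ‖F y‖ ≤ K₀ ^ n * a ^ (4 * n) * Ssum * ((1 + ‖y‖) ^ (6 * n))⁻¹ := by
    rw [← div_eq_mul_inv, le_div_iff₀ hq]; exact h1
  have hyhalf : ∀ i, a * ‖x i‖ ≤ ‖y i‖ + 1 / 2 := fun i => by
    have := norm_ge_of_shift ha.le hyx i
    linarith
  have h3 : ((1 + ‖y‖) ^ (6 * n))⁻¹ ≤ ∏ i, (2 ^ 6 * ((1 + a * ‖x i‖) ^ 6)⁻¹) := by
    have := inv_one_add_norm_pow_le_prod' ha.le x y hyhalf 6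
    rw [inv_pow, ← pow_mul] at this
    exact this
  have h4 : a ^ (4 * n) * ∏ i, (2 ^ 6 * ((1 + a * ‖x i‖) ^ 6)⁻¹) =
      ∏ i, (2 ^ 6 * (a ^ 4 * ((1 + a * ‖x i‖) ^ 6)⁻¹)) := by
    simp only [Finset.prod_mul_distrib, Finset.prod_const, Finset.card_univ, Fintype.card_fin]
    ring
  calc |W x| * ‖F y‖ ≤ K₀ ^ n * a ^ (4 * n) * Ssum * ((1 + ‖y‖) ^ (6 * n))⁻¹ := h2
    _ ≤ K₀ ^ n * a ^ (4 * n) * Ssum * ∏ i, (2 ^ 6 * ((1 + a * ‖x i‖) ^ 6)⁻¹) := by gcongr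
    _ = K₀ ^ n * Ssum * (a ^ (4 * n) * ∏ i, (2 ^ 6 * ((1 + a * ‖x i‖) ^ 6)⁻¹)) := by ring
    _ = K₀ ^ n * Ssum * ∏ i, (2 ^ 6 * (a ^ 4 * ((1 + a * ‖x i‖) ^ 6)⁻¹)) := by rw [h4]

/-- **The a-uniform ABSOLUTE bound for abstract weights at shifted points** (so every sub-sum obeys it too).
`y x` is any evaluation point with `‖(y x)_l − a x_l‖ ≤ s a`; `W` any weight with sup bound `Mⁿ` and collar
bound `(C/R⁴)ⁿ`. -/
theorem sum_abs_weight_mul_norm_le_slack {C ℓ₄ M a s : ℝ} {L n : ℕ} (hℓ : 0 < ℓ₄) (hC : 0 ≤ C) (hM : 0 ≤ M) (σ : ℕ)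
    (W : (Fin n → Site 4) → ℝ) (hWsup : ∀ x, |W x| ≤ M ^ n)
    (H : ∀ (x : Fin n → Site 4) (R : ℕ), 1 ≤ R → (R : ℝ) * a ≤ ℓ₄ → 4 * R + 8 ≤ L →
      (∀ i j : Fin n, i ≠ j → ∃ k : Fin 4,
        (2 * (R : ℤ) + 4) ≤ |((((x i k - x j k : ℤ) : ZMod (2 * L + 1))).valMinAbs : ℤ)|) →
      |W x| ≤ (C / (R : ℝ) ^ 4 * (((R : ℝ) * a)⁻¹) ^ σ) ^ n)
    (ha : 0 < a) (ha1 : a ≤ 1) (haℓ : a ≤ ℓ₄) (hL14 : 14 ≤ L) (hLa : a⁻¹ * a⁻¹ ≤ L) (hn : 2 ≤ n)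
    (hs : 0 ≤ s) (hs6 : s ≤ 6) (hsa : s * a ≤ 1 / 4)
    (F : 𝓢((Fin n → EuclideanSpace ℝ (Fin 4)), ℂ)) (hF : IsOffDiagonal F)
    (y : (Fin n → Site 4) → (Fin n → EuclideanSpace ℝ (Fin 4))) (hyx : ∀ x l, ‖y x l - a • siteToE (x l)‖ ≤ s * a) :
    ∑ x ∈ Fintype.piFinset (fun _ : Fin n => box 4 L), |W x| * ‖F (y x)‖ ≤
      ((M * 4 ^ 4 * 5 ^ 6 + M * 2 ^ 6 * (10 + 2 * s) ^ 4 + 2 ^ (σ + 11) * C * (2 / ℓ₄ + 48) ^ (σ + 4)) * 2 ^ 6 *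
          (81 * ∑' m : ℕ, (((m : ℝ) + 1) ^ 2)⁻¹)) ^ n *
        (SchwartzMap.seminorm ℂ 0 (4 * n) F + SchwartzMap.seminorm ℂ (6 * n) (4 * n) F +
          SchwartzMap.seminorm ℂ 0 ((σ + 4) * n) F + SchwartzMap.seminorm ℂ (6 * n) ((σ + 4) * n) F +
          SchwartzMap.seminorm ℂ 0 0 F + SchwartzMap.seminorm ℂ (6 * n) 0 F +
          SchwartzMap.seminorm ℂ (10 * n) 0 F) := by
  classical
  obtain ⟨K₀, hK₀⟩ : ∃ K₀ : ℝ,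
      M * 4 ^ 4 * 5 ^ 6 + M * 2 ^ 6 * (10 + 2 * s) ^ 4 + 2 ^ (σ + 11) * C * (2 / ℓ₄ + 48) ^ (σ + 4) = K₀ := ⟨_, rfl⟩
  obtain ⟨Z, hZ⟩ : ∃ Z : ℝ, 81 * ∑' m : ℕ, (((m : ℝ) + 1) ^ 2)⁻¹ = Z := ⟨_, rfl⟩
  have hK₀0 : 0 ≤ K₀ := by rw [← hK₀]; positivity
  set Ssum := SchwartzMap.seminorm ℂ 0 (4 * n) F + SchwartzMap.seminorm ℂ (6 * n) (4 * n) F +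
    SchwartzMap.seminorm ℂ 0 ((σ + 4) * n) F + SchwartzMap.seminorm ℂ (6 * n) ((σ + 4) * n) F +
    SchwartzMap.seminorm ℂ 0 0 F + SchwartzMap.seminorm ℂ (6 * n) 0 F + SchwartzMap.seminorm ℂ (10 * n) 0 F
    with hSsum
  have hSsum0 : 0 ≤ Ssum := by positivity
  have hpt : ∀ x : Fin n → Site 4, |W x| * ‖F (y x)‖ ≤
      K₀ ^ n * Ssum * ∏ i, (2 ^ 6 * (a ^ 4 * ((1 + a * ‖x i‖) ^ 6)⁻¹)) := fun x => by
    have h := abs_weight_mul_norm_le_prod_slack hℓ hC hM σ W hWsup H ha ha1 haℓ hL14 hLa hn hs hs6 hsa F hF x (y x) (hyx x)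
    rw [hK₀] at h; exact h
  have hsumZ : ∑ x ∈ Fintype.piFinset (fun _ : Fin n => box 4 L),
      ∏ i, (2 ^ 6 * (a ^ 4 * ((1 + a * ‖x i‖) ^ 6)⁻¹)) ≤ (2 ^ 6 * Z) ^ n := by
    have hfac : ∀ x : Fin n → Site 4, ∏ i, (2 ^ 6 * (a ^ 4 * ((1 + a * ‖x i‖) ^ 6)⁻¹)) =
        (2 : ℝ) ^ (6 * n) * ∏ i, (a ^ 4 * ((1 + a * ‖x i‖) ^ 6)⁻¹) := fun x => by
      rw [Finset.prod_mul_distrib, Finset.prod_const, Finset.card_univ, Fintype.card_fin, ← pow_mul]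
    simp_rw [hfac]
    rw [← Finset.mul_sum, mul_pow, ← pow_mul]
    gcongr
    rw [← hZ]; exact sum_prod_decay_le ha ha1 (le_refl 6) (box 4 L) n
  rw [hK₀, hZ]
  calc ∑ x ∈ Fintype.piFinset (fun _ : Fin n => box 4 L), |W x| * ‖F (y x)‖
      ≤ ∑ x ∈ Fintype.piFinset (fun _ : Fin n => box 4 L),
        K₀ ^ n * Ssum * ∏ i, (2 ^ 6 * (a ^ 4 * ((1 + a * ‖x i‖) ^ 6)⁻¹)) := Finset.sum_le_sum fun x _ => hpt x
    _ = K₀ ^ n * Ssum * ∑ x ∈ Fintype.piFinset (fun _ : Fin n => box 4 L),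
        ∏ i, (2 ^ 6 * (a ^ 4 * ((1 + a * ‖x i‖) ^ 6)⁻¹)) := by rw [Finset.mul_sum]
    _ ≤ K₀ ^ n * Ssum * (2 ^ 6 * Z) ^ n :=
        mul_le_mul_of_nonneg_left hsumZ (mul_nonneg (pow_nonneg hK₀0 n) hSsum0)
    _ = (K₀ * 2 ^ 6 * Z) ^ n * Ssum := by rw [mul_pow, mul_pow, mul_pow]; ring

/-- **The a-uniform bound for abstract weights at shifted points.**  `y x` is any evaluation point with
`‖(y x)_l − a x_l‖ ≤ s a`; `W` any weight with sup bound `Mⁿ` and slack collar bound `(C/R⁴·((R a)⁻¹)^σ)ⁿ`. [folklore] -/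
theorem norm_sum_weight_mul_le_slack {C ℓ₄ M a s : ℝ} {L n : ℕ} (hℓ : 0 < ℓ₄) (hC : 0 ≤ C) (hM : 0 ≤ M) (σ : ℕ)
    (W : (Fin n → Site 4) → ℝ) (hWsup : ∀ x, |W x| ≤ M ^ n)
    (H : ∀ (x : Fin n → Site 4) (R : ℕ), 1 ≤ R → (R : ℝ) * a ≤ ℓ₄ → 4 * R + 8 ≤ L →
      (∀ i j : Fin n, i ≠ j → ∃ k : Fin 4,
        (2 * (R : ℤ) + 4) ≤ |((((x i k - x j k : ℤ) : ZMod (2 * L + 1))).valMinAbs : ℤ)|) →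
      |W x| ≤ (C / (R : ℝ) ^ 4 * (((R : ℝ) * a)⁻¹) ^ σ) ^ n)
    (ha : 0 < a) (ha1 : a ≤ 1) (haℓ : a ≤ ℓ₄) (hL14 : 14 ≤ L) (hLa : a⁻¹ * a⁻¹ ≤ L) (hn : 2 ≤ n)
    (hs : 0 ≤ s) (hs6 : s ≤ 6) (hsa : s * a ≤ 1 / 4)
    (F : 𝓢((Fin n → EuclideanSpace ℝ (Fin 4)), ℂ)) (hF : IsOffDiagonal F)
    (y : (Fin n → Site 4) → (Fin n → EuclideanSpace ℝ (Fin 4))) (hyx : ∀ x l, ‖y x l - a • siteToE (x l)‖ ≤ s * a) :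
    ‖∑ x ∈ Fintype.piFinset (fun _ : Fin n => box 4 L), ((W x : ℝ) : ℂ) * F (y x)‖ ≤
      ((M * 4 ^ 4 * 5 ^ 6 + M * 2 ^ 6 * (10 + 2 * s) ^ 4 + 2 ^ (σ + 11) * C * (2 / ℓ₄ + 48) ^ (σ + 4)) * 2 ^ 6 *
          (81 * ∑' m : ℕ, (((m : ℝ) + 1) ^ 2)⁻¹)) ^ n *
        (SchwartzMap.seminorm ℂ 0 (4 * n) F + SchwartzMap.seminorm ℂ (6 * n) (4 * n) F +
          SchwartzMap.seminorm ℂ 0 ((σ + 4) * n) F + SchwartzMap.seminorm ℂ (6 * n) ((σ + 4) * n) F +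
          SchwartzMap.seminorm ℂ 0 0 F + SchwartzMap.seminorm ℂ (6 * n) 0 F +
          SchwartzMap.seminorm ℂ (10 * n) 0 F) := by
  refine le_trans ?_ (sum_abs_weight_mul_norm_le_slack hℓ hC hM σ W hWsup H ha ha1 haℓ hL14 hLa hn hs hs6 hsa F hF y hyx)
  refine (norm_sum_le _ _).trans (le_of_eq (Finset.sum_congr rfl fun x _ => ?_))
  rw [norm_mul, Complex.norm_real, Real.norm_eq_abs]

end Summit.QuantumFields.YangMills.Theorems.InfiniteVolume.Slack

end
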